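import Summits.ResolutionOfSingularities.ResolutionOfSingularities.Theorems.HilbertSamuelEliminationSigmaMaxModificationsCorridor3WLadderStrataReplay
import HarnessLib

/-!
# [OURS · L1 W4.2] The STRATA-half of the MOVING W-ladder: the kernel decomposition is EXACT (row ⇔ kernels)

Crux chain w42 (`SigmaMaxModifications`, stmt-ResolutionOfSingularities-18506; skeleton `w_ladder` v5b on
`SigmaMaxModificationsCorridor3`, stmt-ResolutionOfSingularities-19249), row «stub-4 → `Moving.Wlow3CharStrataM p`», seat
res-L1-w42-stub-4 (gen 3). Costume check for the triagers: the kernels (b) / (c) / (b-end) / (c-geo) / (c-rep) / (c-reg) of this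
seat's files (p500484, p503069, p503885, p504439, p505314, p506465, `…StrataReplay`) are each IMPLIED by the strata row they
decompose (every kernel quantifies over a moving never-isolated `G`-chain, which the row forbids), and the origin predicate `QNe Q`
is weaker than `Q`; hence `MaxOriginNoMovingNearChainAtQ p N Q (G ∧ ¬Iso) ⇔ (b-end) ∧ (c-geo) ∧ (c-rep)` at `QNe Q`
(`maxOriginNoMovingNearChainAtQ_notIso_iff_geometric_kernels`) — the decomposition loses no strength and adds none. OURS; NOT
statements of the manuscript [Hironaka2017] nor of [CossartJannsenSaito2020]; AI-drafted, weaker than expert review. Pure proofs;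
`--supports stmt-ResolutionOfSingularities-19249`.
-/

noncomputable section

-- plan-1/idea-2 module setting kept (namespace `…Corridor3.Moving` re-enters `…Corridor3`)
set_option linter.dupNamespace false

open CategoryTheory AlgebraicGeometry TopologicalSpace Topology
open Summit.ResolutionOfSingularities.ResolutionOfSingularities.Theorems.CampaignW42
open Literature.AlgebraicGeometry.Resolution Literature.RingTheory.HilbertSamuel
open Literature.AlgebraicGeometry.CossartJannsenSaito2020
open Summit.ResolutionOfSingularities.ResolutionOfSingularities.Theorems.SigmaMaxModificationsCorridor3

universe u

namespace Summit.ResolutionOfSingularities.ResolutionOfSingularities.Theorems.SigmaMaxModificationsCorridor3.Moving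

variable {p N : ℕ} {Q : ℕ → (ℕ → ℕ) → ∀ X : Scheme.{u}, X → Prop} {G : MarkedStage.{u} → Prop}

/-- A moving row at `Q` gives the moving row at the weaker origin predicate `QNe Q`. [folklore] -/
theorem maxOriginNoMovingNearChainAtQ_qNe_of_q {G' : MarkedStage.{u} → Prop} (h : MaxOriginNoMovingNearChainAtQ p N Q G') :
    MaxOriginNoMovingNearChainAtQ p N (QNe Q) G' :=
  fun R hRf hRa ν X _ x hX hQ => h R hRf hRa ν X x hX hQ.1

/-- The strata row implies kernel (b) (vacuously: the chain it speaks of does not exist). [folklore] -/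
theorem strataBirthsSettle_of_row (h : MaxOriginNoMovingNearChainAtQ p N Q fun s => G s ∧ ¬ Iso N s) :
    StrataBirthsSettle p N Q G :=
  fun R hRf hRa ν X _ x hX hQ c h0 hstep hG hnI hmov =>
    (h R hRf hRa ν X x hX hQ ⟨c, h0, hstep, fun n => ⟨hG n, hnI n⟩, hmov⟩).elim

/-- The strata row implies kernel (c). [folklore] -/
theorem strataLineagesFinite_of_row (h : MaxOriginNoMovingNearChainAtQ p N Q fun s => G s ∧ ¬ Iso N s) :
    StrataLineagesFinite p N Q G :=
  fun R hRf hRa ν X _ x hX hQ c h0 hstep hG hnI hmov =>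
    (h R hRf hRa ν X x hX hQ ⟨c, h0, hstep, fun n => ⟨hG n, hnI n⟩, hmov⟩).elim

/-- The strata row implies kernel (b-end). [folklore] -/
theorem strataCycleEndBirthsSettle_of_row (h : MaxOriginNoMovingNearChainAtQ p N Q fun s => G s ∧ ¬ Iso N s) :
    StrataCycleEndBirthsSettle p N Q G :=
  fun R hRf hRa ν X _ x hX hQ c h0 hstep hG hnI hmov =>
    (h R hRf hRa ν X x hX hQ ⟨c, h0, hstep, fun n => ⟨hG n, hnI n⟩, hmov⟩).elim

/-- The strata row implies kernel (c-geo). [folklore] -/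
theorem strataLineageInCentreIO_of_row (h : MaxOriginNoMovingNearChainAtQ p N Q fun s => G s ∧ ¬ Iso N s) :
    StrataLineageInCentreIO p N Q G :=
  fun R hRf hRa ν X _ x hX hQ c h0 hstep hG hnI hmov =>
    (h R hRf hRa ν X x hX hQ ⟨c, h0, hstep, fun n => ⟨hG n, hnI n⟩, hmov⟩).elim

/-- The strata row implies kernel (c-rep). [folklore] -/
theorem strataReplayBlowupsSettle_of_row (h : MaxOriginNoMovingNearChainAtQ p N Q fun s => G s ∧ ¬ Iso N s) :
    StrataReplayBlowupsSettle p N Q G :=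
  fun R hRf hRa ν X _ x hX hQ c h0 hstep hG hnI hmov =>
    (h R hRf hRa ν X x hX hQ ⟨c, h0, hstep, fun n => ⟨hG n, hnI n⟩, hmov⟩).elim

/-- The strata row implies kernel (c-reg). [folklore] -/
theorem strataCycleStartRegular_of_row (h : MaxOriginNoMovingNearChainAtQ p N Q fun s => G s ∧ ¬ Iso N s) :
    StrataCycleStartRegular p N Q G :=
  fun R hRf hRa ν X _ x hX hQ c h0 hstep hG hnI hmov =>
    (h R hRf hRa ν X x hX hQ ⟨c, h0, hstep, fun n => ⟨hG n, hnI n⟩, hmov⟩).elim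

/-- **THE KERNEL DECOMPOSITION IS EXACT**: «no moving, never-isolated `G`-chain from a `Q`-maximal origin» ⇔ the three geometric
kernels (b-end), (c-geo), (c-rep) at the origin predicate `QNe Q`. [cite: CossartJannsenSaito2020, Rem. 6.29 (1), Thm. 6.35, Prop. 6.31] -/
theorem maxOriginNoMovingNearChainAtQ_notIso_iff_geometric_kernels :
    (MaxOriginNoMovingNearChainAtQ p N Q fun s => G s ∧ ¬ Iso N s) ↔
      StrataCycleEndBirthsSettle p N (QNe Q) G ∧ StrataLineageInCentreIO p N (QNe Q) G ∧
        StrataReplayBlowupsSettle p N (QNe Q) G :=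
  ⟨fun h =>
    have h' := maxOriginNoMovingNearChainAtQ_qNe_of_q h
    ⟨strataCycleEndBirthsSettle_of_row h', strataLineageInCentreIO_of_row h', strataReplayBlowupsSettle_of_row h'⟩,
    fun ⟨hend, hgeo, hrep⟩ => maxOriginNoMovingNearChainAtQ_notIso_of_geometric_kernels hend hgeo hrep⟩

/-- … and with (c-reg) in place of (c-rep): also exact. [cite: CossartJannsenSaito2020, Rem. 6.29 (1), Thm. 6.35, Prop. 6.31] -/
theorem maxOriginNoMovingNearChainAtQ_notIso_iff_births_centreIO_cycleStartRegular :
    (MaxOriginNoMovingNearChainAtQ p N Q fun s => G s ∧ ¬ Iso N s) ↔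
      StrataCycleEndBirthsSettle p N (QNe Q) G ∧ StrataLineageInCentreIO p N (QNe Q) G ∧
        StrataCycleStartRegular p N (QNe Q) G :=
  ⟨fun h =>
    have h' := maxOriginNoMovingNearChainAtQ_qNe_of_q h
    ⟨strataCycleEndBirthsSettle_of_row h', strataLineageInCentreIO_of_row h', strataCycleStartRegular_of_row h'⟩,
    fun ⟨hend, hgeo, hreg⟩ => maxOriginNoMovingNearChainAtQ_notIso_of_births_centreIO_cycleStartRegular hend hgeo hreg⟩

/-- By name at `N = 3`, `G = (ē ≤ 2)`: `Wlow3CharStrataM p` ⇔ its three geometric kernels at `QNe (QCharRegime p)`.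
[cite: CossartJannsenSaito2020, Thm. 6.35, Prop. 6.31] -/
theorem wlow3CharStrataM_iff_geometric_kernels {p : ℕ} :
    Wlow3CharStrataM p ↔
      (StrataCycleEndBirthsSettle.{0} p 3 (QNe (Helpers.QCharRegime p)) fun s => s.geomDirDim ≤ 2) ∧
        (StrataLineageInCentreIO.{0} p 3 (QNe (Helpers.QCharRegime p)) fun s => s.geomDirDim ≤ 2) ∧
        (StrataReplayBlowupsSettle.{0} p 3 (QNe (Helpers.QCharRegime p)) fun s => s.geomDirDim ≤ 2) :=
  maxOriginNoMovingNearChainAtQ_notIso_iff_geometric_kernels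

end Summit.ResolutionOfSingularities.ResolutionOfSingularities.Theorems.SigmaMaxModificationsCorridor3.Moving

end
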